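import Summits.HubbardSuperconductivity.HubbardSuperconductivity.Theorems.LevyLogBootstrapBlock2InfDivXXZLevyEquivalence
import Summits.HubbardSuperconductivity.HubbardSuperconductivity.Theorems.LevyLogBootstrapBlock2InfDivXXZGriffithsTriangle
import Summits.HubbardSuperconductivity.HubbardSuperconductivity.Theorems.LevyLogBootstrapBlock2InfDivXXZGriffithsCorner
import Summits.HubbardSuperconductivity.HubbardSuperconductivity.Theorems.LevyLogBootstrapBlock2InfDivXXZAutSymmetry
import Summits.HubbardSuperconductivity.HubbardSuperconductivity.Theorems.LevyLogBootstrapLevyTransportLogBootstrapInputs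
import Summits.HubbardSuperconductivity.HubbardSuperconductivity.Theorems.LevyLogBootstrapLevyTransportPointwiseAnchor
import Literature.Probability.LatticeModels.TorusBlockKernelFlatness
import HarnessLib

/-!
# Crux `Block2InfDivXXZ` (stmt-HubbardSuperconductivity-15048, route `LevyLogBootstrap`):
# the `M = 4`, `Δ = 0` instance is a THEOREM

The crux (infinite divisibility of the 2×2-block transverse kernel `K₂` of every normalised
`S^z_tot = 0` sector ground state of `H_M(Δ) = xxzHamiltonian 1 (torusGraph 2 M) (-1) Δ`, even
`M ≥ 4`, `Δ ∈ [-1, 0]`) is open for general `M`; here its smallest instance becomes a theorem: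
`block2InfDivXXZ_four_zero` — the `M = 4`, `Δ = 0` slice VERBATIM (every Hadamard power
`K₂^{∘s}`, `s ∈ (0,1]`, of the crux's `16 × 16` matrix is positive semidefinite);
`block2InfDivXXZ_four_of_triangle` — the same for every `Δ ∈ [-1, 0]` CONDITIONAL on the
Griffiths triangles `K(x,y) K(y,z) ≤ ½ K(x,z)` of the site kernel `K(x,y) = Re⟨ψ, S⁺_x S⁻_y ψ⟩`
(a theorem at `Δ = 0`, the GKS-II conjecture for `Δ < 0`); `levyCoeff_four_nonneg_of_triangle`
— the Lévy-coefficient form. Mechanism: (1) bookkeeping `Block2Four.blockSum_*` (any even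
swap-symmetric `F` on `(ℤ/4)²`; for ground states via `gs_transverseKernel_eq_sub/neg` and
`sectorGS_transverseCorr_compPerm`): `A = k₂(0,0) = 4F(0) + 8u + 2(v+v')`,
`B = k₂(1,0) = k₂(0,1) = 4u + 2(v+v') + 4w + 4x`, `C = k₂(1,1) = 2(v+v') + 8x + 4y` with
`u = F(1,0)`, `v = F(1,1)`, `v' = F(1,3)`, `w = F(2,0)`, `x = F(2,1)`, `y = F(2,2)`, `F(0) = ½`
(`LevyFloor.transverseKernel_diag`); (2) `C ≤ A` by Gram positivity (`transverse_quadForm_nonneg`,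
`TorusBlock.blockKernel_le_diag`); (3) five triangles give (C1)–(C4) of the SOS certificate
`block2Corner_of_siteTriangle` (`v ↦ (v+v')/2`), so `B² ≤ AC`; (4) `levy_nonneg_of_corner` + the
characters of `(ℤ/2)²`; (5) `block2_rpow_posSemidef_iff_levyCoeff_nonneg`; (6) at `Δ = 0`
ground-state GKS-II (`gs_transverseKernel_triangle`). Sources: Benassi–Lees–Ueltschi, J. Stat.
Phys. 164 (2016) 1157, Thm. 1; Schoenberg (1938); Berg–Christensen–Ressel (1984) Ch. 3 Thm. 2.2;
Tasaki (2020) §2.1, §2.4. No definition is introduced; sorry-free.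
-/

noncomputable section

set_option linter.dupNamespace false

namespace Summit.HubbardSuperconductivity.HubbardSuperconductivity.Theorems.LevyLogBootstrap

open scoped BigOperators Matrix ComplexOrder ComplexConjugate
open Matrix Finset Complex
open Literature.MathematicalPhysics.QuantumLattice Literature.Probability.LatticeModels

namespace Block2Four

/-! ### Finite bookkeeping on the `4 × 4` torus and its `2 × 2` coarse torus -/

/-- Sums over `Fin 2 → α` as iterated sums over the two coordinates. [folklore] -/
theorem sum_torusSite_two {N : Type*} [AddCommMonoid N] {α : Type*} [Fintype α]
    (f : (Fin 2 → α) → N) : ∑ z, f z = ∑ a, ∑ b, f ![a, b] := by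
  rw [← Fintype.sum_equiv (finTwoArrowEquiv α).symm (fun p => f ((finTwoArrowEquiv α).symm p)) f
    fun _ => rfl, Fintype.sum_prod_type]
  rfl

/-- Sums over `ℤ/4`, written out. [folklore] -/
theorem sum_zmod_four {N : Type*} [AddCommMonoid N] (f : ZMod 4 → N) :
    ∑ a, f a = f 0 + f 1 + f 2 + f 3 :=
  Fin.sum_univ_four f

/-- Sums over `ℤ/2`, written out. [folklore] -/
theorem sum_zmod_two {N : Type*} [AddCommMonoid N] (f : ZMod 2 → N) : ∑ a, f a = f 0 + f 1 :=
  Fin.sum_univ_two f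

/-- Representatives in `ℤ/2`. [folklore] -/
theorem val_zero_two : (0 : ZMod 2).val = 0 := rfl
/-- Representatives in `ℤ/2`. [folklore] -/
theorem val_one_two : (1 : ZMod 2).val = 1 := rfl
/-- Arithmetic in `ℤ/4`. [folklore] -/
theorem zero_sub_one_four : (0 : ZMod 4) - 1 = 3 := by decide
/-- Arithmetic in `ℤ/4`. [folklore] -/
theorem two_sub_one_four : (2 : ZMod 4) - 1 = 1 := by decide
/-- Arithmetic in `ℤ/4`. [folklore] -/
theorem three_sub_one_four : (3 : ZMod 4) - 1 = 2 := by decide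

/-- **The real part of a character of `(ℤ/2)²` is a sign**: `Re χ_q(X) = (-1)^{q₀X₀ + q₁X₁}`
(on representatives). [folklore] -/
theorem torusChar_two_re (q X : TorusSite 2 2) :
    (torusChar q X).re = (-1 : ℝ) ^ ((q 0).val * (X 0).val + (q 1).val * (X 1).val) := by
  rw [Literature.Probability.LatticeModels.torusChar_re, Fin.sum_univ_two]
  have h : latticeMomentum 2 q 0 * ((X 0).val : ℝ) + latticeMomentum 2 q 1 * ((X 1).val : ℝ) =
      (((q 0).val * (X 0).val + (q 1).val * (X 1).val : ℕ) : ℝ) * Real.pi := by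
    simp only [latticeMomentum]
    push_cast
    ring
  rw [h, Real.cos_nat_mul_pi]

section Generic

variable (F : TorusSite 2 4 → ℝ) (hneg : ∀ z, F (-z) = F z)
  (hswap : ∀ a b : ZMod 4, F ![a, b] = F ![b, a])
include hneg hswap

/-- **Block bookkeeping on the `4 × 4` torus, block `(0,0)` against block `(0,0)`**: for an even,
swap-symmetric function `F` on `(ℤ/4)²`,
`Σ_{x', y' ∈ block 0} F(x' - y') = 4F(0,0) + 8F(1,0) + 2(F(1,1) + F(1,3))`. [folklore] -/
theorem blockSum_zero_zero :
    (∑ x' : TorusSite 2 4, ∑ y' : TorusSite 2 4,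
      if (∀ i : Fin 2, (x' i).val / 2 = 0) ∧ (∀ i : Fin 2, (y' i).val / 2 = 0)
      then F (x' - y') else 0) =
    4 * F ![0, 0] + 8 * F ![1, 0] + 2 * (F ![1, 1] + F ![1, 3]) := by
  have f30 : F ![3, 0] = F ![1, 0] := by
    rw [← hneg ![1, 0]]; congr 1; decide
  have f01 : F ![0, 1] = F ![1, 0] := hswap 0 1
  have f03 : F ![0, 3] = F ![1, 0] := by
    rw [hswap 0 3, ← hneg ![1, 0]]; congr 1; decide
  have f33 : F ![3, 3] = F ![1, 1] := by
    rw [← hneg ![1, 1]]; congr 1; decide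
  have f31 : F ![3, 1] = F ![1, 3] := hswap 3 1
  simp (config := {decide := true}) only [sum_torusSite_two, sum_zmod_four, Fin.forall_fin_two,
    Matrix.cons_val_zero, Matrix.cons_val_one, Matrix.head_cons, if_true, if_false, and_true,
    and_false, add_zero, Matrix.sub_cons, Matrix.head_cons, Matrix.tail_cons,
    Matrix.empty_sub_empty, sub_zero, zero_sub_one_four, sub_self, f30, f01, f03, f33, f31]
  ring

/-- The same block sum with block `(0,0)` addressed through the coarse site `(0,0) ∈ (ℤ/2)²` (the
literal shape produced by the Lévy-coefficient sum of `…LevyEquivalence.lean`). [folklore] -/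
theorem blockSum_zero_zero' :
    (∑ x' : TorusSite 2 4, ∑ y' : TorusSite 2 4,
      if (∀ i : Fin 2, (x' i).val / 2 = ((![0, 0] : TorusSite 2 2) i).val) ∧
          (∀ i : Fin 2, (y' i).val / 2 = 0)
      then F (x' - y') else 0) =
    4 * F ![0, 0] + 8 * F ![1, 0] + 2 * (F ![1, 1] + F ![1, 3]) := by
  rw [← blockSum_zero_zero F hneg hswap]
  refine Finset.sum_congr rfl fun x' _ => Finset.sum_congr rfl fun y' _ => ?_
  have e : ∀ i : Fin 2, ((![0, 0] : TorusSite 2 2) i).val = 0 := by decide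
  simp only [e]

/-- **Block `(1,0)` against block `(0,0)`**:
`Σ F(x' - y') = 4F(1,0) + 2(F(1,1) + F(1,3)) + 4F(2,0) + 4F(2,1)`. [folklore] -/
theorem blockSum_one_zero :
    (∑ x' : TorusSite 2 4, ∑ y' : TorusSite 2 4,
      if (∀ i : Fin 2, (x' i).val / 2 = ((![1, 0] : TorusSite 2 2) i).val) ∧
          (∀ i : Fin 2, (y' i).val / 2 = 0)
      then F (x' - y') else 0) =
    4 * F ![1, 0] + 2 * (F ![1, 1] + F ![1, 3]) + 4 * F ![2, 0] + 4 * F ![2, 1] := by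
  have f30 : F ![3, 0] = F ![1, 0] := by
    rw [← hneg ![1, 0]]; congr 1; decide
  have f33 : F ![3, 3] = F ![1, 1] := by
    rw [← hneg ![1, 1]]; congr 1; decide
  have f31 : F ![3, 1] = F ![1, 3] := hswap 3 1
  have f23 : F ![2, 3] = F ![2, 1] := by
    rw [← hneg ![2, 1]]; congr 1; decide
  simp (config := {decide := true}) only [sum_torusSite_two, sum_zmod_four, Fin.forall_fin_two,
    Matrix.cons_val_zero, Matrix.cons_val_one, Matrix.head_cons, val_zero_two, val_one_two,
    if_true, if_false, and_true, and_false, add_zero, zero_add, Matrix.sub_cons, Matrix.head_cons,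
    Matrix.tail_cons, Matrix.empty_sub_empty, sub_zero,
    zero_sub_one_four, two_sub_one_four, three_sub_one_four, sub_self, f30, f33, f31, f23]
  ring

/-- **Block `(0,1)` against block `(0,0)`**: the same value as block `(1,0)` (swap symmetry),
`4F(1,0) + 2(F(1,1) + F(1,3)) + 4F(2,0) + 4F(2,1)`. [folklore] -/
theorem blockSum_zero_one :
    (∑ x' : TorusSite 2 4, ∑ y' : TorusSite 2 4,
      if (∀ i : Fin 2, (x' i).val / 2 = ((![0, 1] : TorusSite 2 2) i).val) ∧
          (∀ i : Fin 2, (y' i).val / 2 = 0)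
      then F (x' - y') else 0) =
    4 * F ![1, 0] + 2 * (F ![1, 1] + F ![1, 3]) + 4 * F ![2, 0] + 4 * F ![2, 1] := by
  have f01 : F ![0, 1] = F ![1, 0] := hswap 0 1
  have f03 : F ![0, 3] = F ![1, 0] := by
    rw [hswap 0 3, ← hneg ![1, 0]]; congr 1; decide
  have f02 : F ![0, 2] = F ![2, 0] := hswap 0 2
  have f33 : F ![3, 3] = F ![1, 1] := by
    rw [← hneg ![1, 1]]; congr 1; decide
  have f31 : F ![3, 1] = F ![1, 3] := hswap 3 1
  have f12 : F ![1, 2] = F ![2, 1] := hswap 1 2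
  have f32 : F ![3, 2] = F ![2, 1] := by
    rw [hswap 3 2, ← hneg ![2, 1]]; congr 1; decide
  simp (config := {decide := true}) only [sum_torusSite_two, sum_zmod_four, Fin.forall_fin_two,
    Matrix.cons_val_zero, Matrix.cons_val_one, Matrix.head_cons, val_zero_two, val_one_two,
    if_true, if_false, and_true, and_false, add_zero, zero_add, Matrix.sub_cons, Matrix.head_cons,
    Matrix.tail_cons, Matrix.empty_sub_empty, sub_zero,
    zero_sub_one_four, two_sub_one_four, three_sub_one_four, sub_self, f01, f03, f02, f33, f31,
    f12, f32]
  ring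

/-- **Block `(1,1)` against block `(0,0)`**:
`Σ F(x' - y') = 2(F(1,1) + F(1,3)) + 8F(2,1) + 4F(2,2)`. [folklore] -/
theorem blockSum_one_one :
    (∑ x' : TorusSite 2 4, ∑ y' : TorusSite 2 4,
      if (∀ i : Fin 2, (x' i).val / 2 = ((![1, 1] : TorusSite 2 2) i).val) ∧
          (∀ i : Fin 2, (y' i).val / 2 = 0)
      then F (x' - y') else 0) =
    2 * (F ![1, 1] + F ![1, 3]) + 8 * F ![2, 1] + 4 * F ![2, 2] := by
  have f33 : F ![3, 3] = F ![1, 1] := by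
    rw [← hneg ![1, 1]]; congr 1; decide
  have f31 : F ![3, 1] = F ![1, 3] := hswap 3 1
  have f23 : F ![2, 3] = F ![2, 1] := by
    rw [← hneg ![2, 1]]; congr 1; decide
  have f12 : F ![1, 2] = F ![2, 1] := hswap 1 2
  have f32 : F ![3, 2] = F ![2, 1] := by
    rw [hswap 3 2, ← hneg ![2, 1]]; congr 1; decide
  simp (config := {decide := true}) only [sum_torusSite_two, sum_zmod_four, Fin.forall_fin_two,
    Matrix.cons_val_zero, Matrix.cons_val_one, Matrix.head_cons, val_one_two,
    if_true, if_false, and_true, and_false, add_zero, zero_add, Matrix.sub_cons, Matrix.head_cons,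
    Matrix.tail_cons, Matrix.empty_sub_empty, sub_zero,
    zero_sub_one_four, two_sub_one_four, three_sub_one_four, sub_self, f33, f31, f23, f12, f32]
  ring

end Generic

end Block2Four
open Block2Four

/-! ### The `4 × 4` torus: Lévy coefficients of the block kernel from site Griffiths inequalities -/

section FourTorus

/-- **`M = 4`: the three Lévy coefficients of the 2×2-block kernel are nonnegative as soon as the
site kernel satisfies the Griffiths triangle inequalities** `K(x,y) K(y,z) ≤ ½ K(x,z)` (pairwise
distinct sites), for every `Δ ∈ [-1, 0]` and every normalised `S^z_tot = 0` sector ground state `ψ`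
of `H_4(Δ)`: with `A = k₂(0,0) = 2 + 8u + 2(v + v')`, `B = k₂(1,0) = k₂(0,1) = 4u + 2(v + v') + 4w + 4x`,
`C = k₂(1,1) = 2(v + v') + 8x + 4y` (`u = K(1,0)`, `v = K(1,1)`, `v' = K(1,3)`, `w = K(2,0)`,
`x = K(2,1)`, `y = K(2,2)`; `Block2Four.blockSum_*`), Gram positivity gives `C ≤ A`, five triangles
give (C1)–(C4) of `block2Corner_of_siteTriangle` (`v ↦ (v + v')/2`), hence `B² ≤ A C`, and
`levy_nonneg_of_corner` yields `ν₍₁,₀₎ = ν₍₀,₁₎ = log A - log C ≥ 0`,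
`ν₍₁,₁₎ = log A - 2 log B + log C ≥ 0`. [folklore] -/
theorem levyCoeff_four_nonneg_of_triangle (Δ : ℝ) (hΔ : Δ ∈ Set.Icc (-1:ℝ) 0)
    (ψ : TensorIndex (TorusSite 2 4) 2 → ℂ)
    (hψ : ψ ∈ @spinZSector (TorusSite 2 4) _ _ 1 0) (hnorm : star ψ ⬝ᵥ ψ = 1)
    (heig : Matrix.mulVec (xxzHamiltonian 1 (torusGraph 2 4) (-1) Δ) ψ =
      ((lowestEnergyInSector 1 (xxzHamiltonian 1 (torusGraph 2 4) (-1) Δ) 0 : ℝ) : ℂ) • ψ)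
    (hG : ∀ x y z : TorusSite 2 4, x ≠ y → y ≠ z → x ≠ z →
      (star ψ ⬝ᵥ (onSite x (spinRaise 1) * onSite y (spinLower 1)) *ᵥ ψ).re *
          (star ψ ⬝ᵥ (onSite y (spinRaise 1) * onSite z (spinLower 1)) *ᵥ ψ).re ≤
        1 / 2 * (star ψ ⬝ᵥ (onSite x (spinRaise 1) * onSite z (spinLower 1)) *ᵥ ψ).re) :
    ∀ q : TorusSite 2 2, q ≠ 0 →
      0 ≤ ∑ X : TorusSite 2 2, Real.log (∑ x' : TorusSite 2 4, ∑ y' : TorusSite 2 4,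
            if (∀ i : Fin 2, (x' i).val / 2 = (X i).val) ∧ (∀ i : Fin 2, (y' i).val / 2 = 0) then
              (star ψ ⬝ᵥ Matrix.mulVec
                (onSite x' (spinRaise 1) * onSite y' (spinLower 1)) ψ).re
            else 0) * (torusChar q X).re := by
  intro q hq
  have hEven : Even 4 := ⟨2, rfl⟩
  -- the site kernel `K` and the difference kernel `F`
  set K : TorusSite 2 4 → TorusSite 2 4 → ℝ := fun a b =>
    (star ψ ⬝ᵥ (onSite a (spinRaise 1) * onSite b (spinLower 1)) *ᵥ ψ).re with hKdef
  set F : TorusSite 2 4 → ℝ := fun z => K z 0 with hFdef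
  have hKF : ∀ a b : TorusSite 2 4,
      (star ψ ⬝ᵥ (onSite a (spinRaise 1) * onSite b (spinLower 1)) *ᵥ ψ).re = F (a - b) :=
    fun a b => gs_transverseKernel_eq_sub 4 hEven Δ ψ hψ hnorm heig a b
  have hneg : ∀ z, F (-z) = F z := fun z => gs_transverseKernel_neg 4 hEven Δ ψ hψ hnorm heig z
  have hswap : ∀ a b : ZMod 4, F ![a, b] = F ![b, a] := by
    intro a b
    have h := sectorGS_transverseCorr_compPerm 4 Δ 0 (Equiv.swap (0 : Fin 2) 1) ψ hψ heig ![b, a] 0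
    have e1 : ((![b, a] : TorusSite 2 4) ∘ (Equiv.swap (0 : Fin 2) 1)) = ![a, b] := by
      ext i; fin_cases i <;> rfl
    have e2 : ((0 : TorusSite 2 4) ∘ (Equiv.swap (0 : Fin 2) 1)) = 0 := rfl
    rw [e1, e2] at h
    show (star ψ ⬝ᵥ (onSite ![a, b] (spinRaise 1) * onSite 0 (spinLower 1)) *ᵥ ψ).re =
      (star ψ ⬝ᵥ (onSite ![b, a] (spinRaise 1) * onSite 0 (spinLower 1)) *ᵥ ψ).re
    rw [h]
  -- positivity, the bound `½`, half filling
  have hpos : ∀ a b, 0 < K a b := fun a b =>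
    stub_transverseKernelPos 4 hEven le_rfl Δ hΔ ψ hψ hnorm heig a b
  have hle : ∀ a b, K a b ≤ 1 / 2 := fun a b =>
    transverseKernel_le_half 4 hEven Δ ψ hψ hnorm heig a b
  have hF00 : F ![0, 0] = 1 / 2 := by
    have e : (![0, 0] : TorusSite 2 4) = 0 := by decide
    show K ![0, 0] 0 = 1 / 2
    rw [e]
    exact LevyFloor.transverseKernel_diag 4 hEven Δ ψ hψ hnorm heig 0
  have hFpos : ∀ z, 0 < F z := fun z => hpos z 0
  have hFle : ∀ z, F z ≤ 1 / 2 := fun z => hle z 0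
  -- `C ≤ A`: positivity of the Gram form (flatness of block kernels)
  have hT : ∀ v a b : TorusSite 2 4, K (a + v) (b + v) = K a b := fun v a b =>
    gs_transverseKernel_translate 4 hEven Δ ψ hψ hnorm heig v a b
  have hS : ∀ a b : TorusSite 2 4, K a b = K b a := fun a b => re_expect_raiseLower_symm 1 ψ a b
  have hP : ∀ c : TorusSite 2 4 → ℝ, 0 ≤ ∑ a, ∑ b, c a * c b * K a b := fun c =>
    transverse_quadForm_nonneg 1 ψ c
  have hCA := TorusBlock.blockKernel_le_diag (d := 2) (b := 2) (m := 2) (M := 4) (by norm_num)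
    K hT hS hP ![2, 2] 0
  have e22 : ∀ i : Fin 2, ((![2, 2] : TorusSite 2 4) i).val / 2 = ((![1, 1] : TorusSite 2 2) i).val := by
    decide
  have ez : ∀ i : Fin 2, ((0 : TorusSite 2 4) i).val / 2 = 0 := by decide
  have hKF' : ∀ a b : TorusSite 2 4, K a b = F (a - b) := hKF
  simp only [e22, ez, hKF'] at hCA
  rw [blockSum_one_one F hneg hswap, blockSum_zero_zero F hneg hswap, hF00] at hCA
  -- the five Griffiths triangles
  have d1 : (![1, 1] : TorusSite 2 4) - ![0, 1] = ![1, 0] := by decide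
  have d2 : (![1, 3] : TorusSite 2 4) - ![0, 3] = ![1, 0] := by decide
  have d3 : (![2, 1] : TorusSite 2 4) - ![2, 0] = ![0, 1] := by decide
  have d4 : (![2, 2] : TorusSite 2 4) - ![2, 0] = ![0, 2] := by decide
  have d5 : (![0, 1] : TorusSite 2 4) - ![2, 1] = ![2, 0] := by decide
  have f01 : F ![0, 1] = F ![1, 0] := hswap 0 1
  have f03 : F ![0, 3] = F ![1, 0] := by
    rw [hswap 0 3, ← hneg ![1, 0]]; congr 1; decide
  have f02 : F ![0, 2] = F ![2, 0] := hswap 0 2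
  have T1 := hG ![1, 1] ![0, 1] 0 (by decide) (by decide) (by decide)
  have T2 := hG ![1, 3] ![0, 3] 0 (by decide) (by decide) (by decide)
  have T3 := hG ![2, 1] ![2, 0] 0 (by decide) (by decide) (by decide)
  have T4 := hG ![2, 2] ![2, 0] 0 (by decide) (by decide) (by decide)
  have T5 := hG ![0, 1] ![2, 1] 0 (by decide) (by decide) (by decide)
  simp only [hKF, sub_zero, d1, d2, d3, d4, d5, f01, f03, f02] at T1 T2 T3 T4 T5
  -- the corner inequality `B² ≤ A C` from the SOS certificate
  have hu0 : 0 ≤ F ![1, 0] := (hFpos _).le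
  have hw0 : 0 ≤ F ![2, 0] := (hFpos _).le
  have hcorner : (4 * F ![1, 0] + 2 * (F ![1, 1] + F ![1, 3]) + 4 * F ![2, 0] + 4 * F ![2, 1]) ^ 2 ≤
      (4 * (1 / 2) + 8 * F ![1, 0] + 2 * (F ![1, 1] + F ![1, 3])) *
        (2 * (F ![1, 1] + F ![1, 3]) + 8 * F ![2, 1] + 4 * F ![2, 2]) := by
    have h := block2Corner_of_siteTriangle (1 / 2) (F ![1, 0]) ((F ![1, 1] + F ![1, 3]) / 2)
      (F ![2, 0]) (F ![2, 1]) (F ![2, 2]) (by norm_num) hu0 hw0 (hFle _) (hFle _) (hFle _)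
      (by nlinarith [T1, T2]) (by nlinarith [T3]) (by nlinarith [T4]) (by nlinarith [T5])
    have e1 : 4 * (F ![1, 0] + (F ![1, 1] + F ![1, 3]) / 2 + F ![2, 0] + F ![2, 1]) =
        4 * F ![1, 0] + 2 * (F ![1, 1] + F ![1, 3]) + 4 * F ![2, 0] + 4 * F ![2, 1] := by ring
    have e2 : 4 * (1 / 2) + 8 * F ![1, 0] + 4 * ((F ![1, 1] + F ![1, 3]) / 2) =
        4 * (1 / 2) + 8 * F ![1, 0] + 2 * (F ![1, 1] + F ![1, 3]) := by ring
    have e3 : 4 * ((F ![1, 1] + F ![1, 3]) / 2) + 8 * F ![2, 1] + 4 * F ![2, 2] =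
        2 * (F ![1, 1] + F ![1, 3]) + 8 * F ![2, 1] + 4 * F ![2, 2] := by ring
    rw [e1, e2, e3] at h
    exact h
  have hB : 0 < 4 * F ![1, 0] + 2 * (F ![1, 1] + F ![1, 3]) + 4 * F ![2, 0] + 4 * F ![2, 1] := by
    linarith [hFpos ![1, 1], hFpos ![1, 3], hFpos ![2, 0], hFpos ![2, 1]]
  have hC : 0 < 2 * (F ![1, 1] + F ![1, 3]) + 8 * F ![2, 1] + 4 * F ![2, 2] := by
    linarith [hFpos ![1, 1], hFpos ![1, 3], hFpos ![2, 1], hFpos ![2, 2]]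
  have hL := levy_nonneg_of_corner _ _ _ hB hC hCA hcorner
  -- rewrite the Lévy coefficient through the explicit block values
  simp_rw [hKF]
  rw [sum_torusSite_two (α := ZMod 2)]
  simp only [sum_zmod_two]
  rw [blockSum_zero_zero' F hneg hswap, blockSum_zero_one F hneg hswap,
    blockSum_one_zero F hneg hswap, blockSum_one_one F hneg hswap, hF00]
  -- the three nonzero characters of `(ℤ/2)²`
  obtain ⟨a, b, rfl⟩ : ∃ a b : ZMod 2, q = ![a, b] := ⟨q 0, q 1, by ext i; fin_cases i <;> rfl⟩
  have key : ∀ c : ZMod 2, c = 0 ∨ c = 1 := by decide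
  rcases key a with rfl | rfl <;> rcases key b with rfl | rfl
  · exact (hq (by decide)).elim
  · simp only [torusChar_two_re, Matrix.cons_val_zero, Matrix.cons_val_one, val_zero_two,
      val_one_two]
    norm_num
    linarith [hL.1]
  · simp only [torusChar_two_re, Matrix.cons_val_zero, Matrix.cons_val_one, val_zero_two,
      val_one_two]
    norm_num
    linarith [hL.1]
  · simp only [torusChar_two_re, Matrix.cons_val_zero, Matrix.cons_val_one, val_zero_two,
      val_one_two]
    norm_num
    linarith [hL.2]

/-- **The `M = 4` slice of the crux `Block2InfDivXXZ`, conditional on the site Griffiths triangle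
inequalities.** For every `Δ ∈ [-1, 0]` and every normalised `S^z_tot = 0` sector ground state `ψ`
of `H_4(Δ) = xxzHamiltonian 1 (torusGraph 2 4) (-1) Δ` whose transverse kernel satisfies
`K(x,y) K(y,z) ≤ ½ K(x,z)` for pairwise distinct sites, every fractional Hadamard power of the
2×2-block kernel (the `16 × 16` matrix of the crux, verbatim at `M = 4`) is positive semidefinite
(`levyCoeff_four_nonneg_of_triangle` + `block2_rpow_posSemidef_iff_levyCoeff_nonneg`). The
hypothesis is a theorem at `Δ = 0` (next result) and the Griffiths–Ginibre conjecture for the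
easy-plane XXZ sector ground state for `Δ < 0`. [folklore] -/
theorem block2InfDivXXZ_four_of_triangle (Δ : ℝ) (hΔ : Δ ∈ Set.Icc (-1:ℝ) 0)
    (ψ : TensorIndex (TorusSite 2 4) 2 → ℂ)
    (hψ : ψ ∈ @spinZSector (TorusSite 2 4) _ _ 1 0) (hnorm : star ψ ⬝ᵥ ψ = 1)
    (heig : Matrix.mulVec (xxzHamiltonian 1 (torusGraph 2 4) (-1) Δ) ψ =
      ((lowestEnergyInSector 1 (xxzHamiltonian 1 (torusGraph 2 4) (-1) Δ) 0 : ℝ) : ℂ) • ψ)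
    (hG : ∀ x y z : TorusSite 2 4, x ≠ y → y ≠ z → x ≠ z →
      (star ψ ⬝ᵥ (onSite x (spinRaise 1) * onSite y (spinLower 1)) *ᵥ ψ).re *
          (star ψ ⬝ᵥ (onSite y (spinRaise 1) * onSite z (spinLower 1)) *ᵥ ψ).re ≤
        1 / 2 * (star ψ ⬝ᵥ (onSite x (spinRaise 1) * onSite z (spinLower 1)) *ᵥ ψ).re) :
    ∀ s : ℝ, 0 < s → s ≤ 1 →
      (Matrix.of fun (x y : TorusSite 2 4) => (∑ x' : TorusSite 2 4, ∑ y' : TorusSite 2 4,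
        if (∀ i : Fin 2, (x' i).val / 2 = (x i).val / 2) ∧ (∀ i : Fin 2, (y' i).val / 2 = (y i).val / 2)
        then (star ψ ⬝ᵥ Matrix.mulVec (onSite x' (spinRaise 1) * onSite y' (spinLower 1)) ψ).re
        else 0) ^ s).PosSemidef := by
  haveI : NeZero (4 / 2) := ⟨by decide⟩
  exact (block2_rpow_posSemidef_iff_levyCoeff_nonneg 4 ⟨2, rfl⟩ le_rfl Δ hΔ ψ hψ hnorm heig).2
    (levyCoeff_four_nonneg_of_triangle Δ hΔ ψ hψ hnorm heig hG)

/-- **The `M = 4`, `Δ = 0` instance of the crux `Block2InfDivXXZ` is a theorem.** For every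
normalised `S^z_tot = 0` sector ground state `ψ` of the XY Hamiltonian
`H_4(0) = xxzHamiltonian 1 (torusGraph 2 4) (-1) 0` on the `4 × 4` torus and every `s ∈ (0, 1]`, the
fractional Hadamard power `K₂^{∘s}` of the 2×2-block transverse kernel (the crux's `16 × 16` matrix,
verbatim) is positive semidefinite. The Griffiths hypothesis of `block2InfDivXXZ_four_of_triangle`
is discharged by ground-state GKS-II for the spin-½ XY model (`gs_transverseKernel_triangle`,
Benassi–Lees–Ueltschi 2016 Thm. 1 at `β → ∞` + uniqueness of the torus ground state). First
rigorous instance of the route's standing conjecture K1; structurally: translation/point-group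
covariance + Perron–Frobenius positivity + Gram positivity + Griffiths–Ginibre, no reflection
positivity. [cite: BenassiLeesUeltschi2016, Thm. 1] -/
theorem block2InfDivXXZ_four_zero :
    ∀ (ψ : TensorIndex (TorusSite 2 4) 2 → ℂ), ψ ∈ @spinZSector (TorusSite 2 4) _ _ 1 0 →
      star ψ ⬝ᵥ ψ = 1 →
      Matrix.mulVec (xxzHamiltonian 1 (torusGraph 2 4) (-1) 0) ψ =
        ((lowestEnergyInSector 1 (xxzHamiltonian 1 (torusGraph 2 4) (-1) 0) 0 : ℝ) : ℂ) • ψ →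
      ∀ s : ℝ, 0 < s → s ≤ 1 →
        (Matrix.of fun (x y : TorusSite 2 4) => (∑ x' : TorusSite 2 4, ∑ y' : TorusSite 2 4,
          if (∀ i : Fin 2, (x' i).val / 2 = (x i).val / 2) ∧
              (∀ i : Fin 2, (y' i).val / 2 = (y i).val / 2)
          then (star ψ ⬝ᵥ Matrix.mulVec (onSite x' (spinRaise 1) * onSite y' (spinLower 1)) ψ).re
          else 0) ^ s).PosSemidef :=
  fun ψ hψ hnorm heig =>
    block2InfDivXXZ_four_of_triangle 0 ⟨by norm_num, le_rfl⟩ ψ hψ hnorm heig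
      fun _ _ _ hxy hyz hxz =>
        gs_transverseKernel_triangle 4 ⟨2, rfl⟩ le_rfl ψ hψ hnorm heig hxy hyz hxz

end FourTorus

end Summit.HubbardSuperconductivity.HubbardSuperconductivity.Theorems.LevyLogBootstrap

end
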